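import Literature.Analysis.Complex.CousinProblemsConvex
import Literature.Geometry.Kaehler.ChartTransport
import Literature.Geometry.Kaehler.PluriharmonicLog
import HarnessLib

/-!
# Cousin I on chart-convex open subsets of a complex manifold

Transport of `Literature.Analysis.Complex.exists_holomorphic_cochain_of_cocycle_of_convex`
(Cousin I, i.e. `Ȟ¹(𝔘, 𝒪) = 0` for EVERY open cover `𝔘` of a convex open subset of `ℂ^ι`;
K. Fritzsche, H. Grauert (2002), Ch. V §1 Prop. 1.6, Ch. VI §2 Thm. 2.9) first to convex open
subsets of an arbitrary finite-dimensional complex normed space (through a linear isomorphism with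
`ℂ^d`, `exists_holomorphic_cochain_of_cocycle_of_convex`), then to the CHART-CONVEX open subsets
`chartSet 𝓘(ℝ, E) x₀ C` of a complex manifold (the tree's chart sets use the real model; the
extended charts agree, `extChartAt_real_eq_complex`) (`C` open convex in the target of the chart at `x₀`;
holomorphy is read in the holomorphic chart, `differentiableOn_comp_extChartAt_symm_of_mdifferentiableOn`):
`exists_mdifferentiableOn_cochain_of_cocycle_chartSet`. These are exactly the finite
intersections of the nested Leray covers of the Cartan–Serre finiteness theorem
(`DolbeaultLerayDatum.cechSet_eq`), on which the division / extension / regular-sequence problems of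
the hyperplane-section bookkeeping are patched.

Everything is proved; theorems only.

## References

* K. Fritzsche, H. Grauert, *From Holomorphic Functions to Complex Manifolds*, GTM 213 (2002),
  Ch. V §1 Prop. 1.6, Ch. VI §2 Thm. 2.9. [FritzscheGrauert2002]
* C. Voisin, *Hodge Theory and Complex Algebraic Geometry I* (2002), §2.2.1 (holomorphy is read
  in holomorphic charts). [VoisinHodgeI2002]
-/

noncomputable section

open scoped Manifold ContDiff Topology
open Set Filter

namespace Literature.Geometry.Kaehler

/-! ### Convex open subsets of a finite-dimensional complex normed space -/

section Flat

variable {E : Type*} [NormedAddCommGroup E] [NormedSpace ℂ E] [FiniteDimensional ℂ E] {κ : Type*}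

/-- **Cousin I on a convex open subset of a finite-dimensional complex normed space**:
`Ȟ¹(𝔘, 𝒪) = 0` for every open cover `𝔘 = (U_k)` of a convex open `Ω ⊆ E` — every holomorphic
`1`-cocycle `c_{kl}` on `U_k ∩ U_l` is `h_k - h_l` with `h_k` holomorphic on `U_k`. (The case
`E = ℂ^ι` is `Literature.Analysis.Complex.exists_holomorphic_cochain_of_cocycle_of_convex`;
transport through a `ℂ`-linear isomorphism `E ≃ ℂ^d`.)
[cite: FritzscheGrauert2002, Ch. V §1 Prop. 1.6 and Ch. VI §2 Thm. 2.9] -/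
theorem exists_holomorphic_cochain_of_cocycle_of_convex {Ω : Set E} (hΩo : IsOpen Ω)
    (hΩc : Convex ℝ Ω) (U : κ → Set E) (hU : ∀ k, IsOpen (U k)) (hUΩ : ∀ k, U k ⊆ Ω)
    (hcov : ∀ x ∈ Ω, ∃ k, x ∈ U k) (c : κ → κ → E → ℂ)
    (hc : ∀ k l, DifferentiableOn ℂ (c k l) (U k ∩ U l))
    (hcyc : ∀ k l m, ∀ x ∈ U k ∩ U l ∩ U m, c k l x + c l m x = c k m x) :
    ∃ h : κ → E → ℂ, (∀ k, DifferentiableOn ℂ (h k) (U k)) ∧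
      ∀ k l, ∀ x ∈ U k ∩ U l, c k l x = h k x - h l x := by
  -- a linear isomorphism with `ℂ^d`
  set d : ℕ := Module.finrank ℂ E with hd
  obtain ⟨e⟩ : Nonempty (E ≃L[ℂ] (Fin d → ℂ)) :=
    ⟨ContinuousLinearEquiv.ofFinrankEq (by rw [hd, Module.finrank_fintype_fun_eq_card, Fintype.card_fin])⟩
  -- transported data
  set Ω' : Set (Fin d → ℂ) := e.symm ⁻¹' Ω with hΩ'
  set U' : κ → Set (Fin d → ℂ) := fun k ↦ e.symm ⁻¹' U k with hU'
  set c' : κ → κ → (Fin d → ℂ) → ℂ := fun k l y ↦ c k l (e.symm y) with hc'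
  have hΩ'o : IsOpen Ω' := hΩo.preimage e.symm.continuous
  have hΩ'c : Convex ℝ Ω' :=
    hΩc.linear_preimage ((e.symm : (Fin d → ℂ) →L[ℂ] E).toLinearMap.restrictScalars ℝ)
  have hU'o : ∀ k, IsOpen (U' k) := fun k ↦ (hU k).preimage e.symm.continuous
  have hU'Ω : ∀ k, U' k ⊆ Ω' := fun k y hy ↦ hUΩ k hy
  have hcov' : ∀ y ∈ Ω', ∃ k, y ∈ U' k := fun y hy ↦ hcov (e.symm y) hy
  have hc'd : ∀ k l, DifferentiableOn ℂ (c' k l) (U' k ∩ U' l) := fun k l ↦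
    (hc k l).comp e.symm.differentiableOn fun y hy ↦ hy
  have hcyc' : ∀ k l m, ∀ y ∈ U' k ∩ U' l ∩ U' m, c' k l y + c' l m y = c' k m y :=
    fun k l m y hy ↦ hcyc k l m (e.symm y) hy
  obtain ⟨h', hh', hhc'⟩ := Literature.Analysis.Complex.exists_holomorphic_cochain_of_cocycle_of_convex
    hΩ'o hΩ'c U' hU'o hU'Ω hcov' c' hc'd hcyc'
  refine ⟨fun k x ↦ h' k (e x), fun k ↦ ?_, fun k l x hx ↦ ?_⟩
  · refine (hh' k).comp e.differentiableOn fun x hx ↦ ?_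
    change e.symm (e x) ∈ U k
    rwa [e.symm_apply_apply]
  · have hx' : e x ∈ U' k ∩ U' l := by
      change e.symm (e x) ∈ U k ∧ e.symm (e x) ∈ U l
      rw [e.symm_apply_apply]
      exact hx
    have := hhc' k l (e x) hx'
    simp only [hc', e.symm_apply_apply] at this
    exact this

end Flat

/-! ### Chart-convex open subsets of a complex manifold -/

section Manifold

variable {E : Type*} [NormedAddCommGroup E] [NormedSpace ℂ E] [FiniteDimensional ℂ E]
  {M : Type*} [TopologicalSpace M] [ChartedSpace E M] [IsManifold 𝓘(ℂ, E) ω M] {κ : Type*}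

omit [FiniteDimensional ℂ E] [IsManifold 𝓘(ℂ, E) ω M] in
/-- The real and complex extended charts of a complex manifold agree (both are the chart at the
point followed by the identity model), so that the chart sets `chartSet 𝓘(ℝ, E) x₀ C` of the
tree (real model) are read in HOLOMORPHIC charts. [folklore] -/
theorem extChartAt_real_eq_complex (x₀ : M) : extChartAt 𝓘(ℝ, E) x₀ = extChartAt 𝓘(ℂ, E) x₀ :=
  rfl

/-- **Cousin I on a chart-convex open subset of a complex manifold: `Ȟ¹(𝔘, 𝒪) = 0` for every
open cover.** Let `W = chartSet 𝓘(ℝ, E) x₀ C` with `C` open, convex, inside the target of the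
chart at `x₀`, and let `(V_k)` be an open cover of `W` by subsets of `W`. Every holomorphic
`1`-cocycle (`c_{kl}` holomorphic on `V_k ∩ V_l`, `c_{kl} + c_{lm} = c_{km}` on triple overlaps)
is a coboundary: `c_{kl} = h_k - h_l` with `h_k` holomorphic on `V_k`. (Read everything in the
holomorphic chart at `x₀` and apply the flat statement on `C`.)
[cite: FritzscheGrauert2002, Ch. V §1 Prop. 1.6 and Ch. VI §2 Thm. 2.9] -/
theorem exists_mdifferentiableOn_cochain_of_cocycle_chartSet (x₀ : M) {C : Set E} (hCo : IsOpen C)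
    (hCc : Convex ℝ C) (hCT : C ⊆ (extChartAt 𝓘(ℝ, E) x₀).target) (V : κ → Set M)
    (hV : ∀ k, IsOpen (V k)) (hVW : ∀ k, V k ⊆ chartSet 𝓘(ℝ, E) x₀ C)
    (hcov : ∀ x ∈ chartSet 𝓘(ℝ, E) x₀ C, ∃ k, x ∈ V k) (c : κ → κ → M → ℂ)
    (hc : ∀ k l, MDifferentiableOn 𝓘(ℂ, E) 𝓘(ℂ, ℂ) (c k l) (V k ∩ V l))
    (hcyc : ∀ k l m, ∀ x ∈ V k ∩ V l ∩ V m, c k l x + c l m x = c k m x) :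
    ∃ h : κ → M → ℂ, (∀ k, MDifferentiableOn 𝓘(ℂ, E) 𝓘(ℂ, ℂ) (h k) (V k)) ∧
      ∀ k l, ∀ x ∈ V k ∩ V l, c k l x = h k x - h l x := by
  set φ := extChartAt 𝓘(ℂ, E) x₀ with hφ
  -- the cover and the cocycle read in the chart
  set U' : κ → Set E := fun k ↦ φ.target ∩ φ.symm ⁻¹' V k with hU'
  set c' : κ → κ → E → ℂ := fun k l ↦ c k l ∘ φ.symm with hc'
  have hU'o : ∀ k, IsOpen (U' k) := fun k ↦
    (continuousOn_extChartAt_symm x₀).isOpen_inter_preimage (isOpen_extChartAt_target x₀) (hV k)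
  have hU'C : ∀ k, U' k ⊆ C := fun k y hy ↦ by
    have h1 : φ.symm y ∈ chartSet 𝓘(ℝ, E) x₀ C := hVW k hy.2
    have h2 : φ (φ.symm y) ∈ C := (mem_chartSet_iff.1 h1).2
    rwa [φ.right_inv hy.1] at h2
  have hcov' : ∀ y ∈ C, ∃ k, y ∈ U' k := fun y hy ↦ by
    obtain ⟨k, hk⟩ := hcov _ (symm_mem_chartSet hCT hy)
    exact ⟨k, hCT hy, hk⟩
  have hc'd : ∀ k l, DifferentiableOn ℂ (c' k l) (U' k ∩ U' l) := fun k l ↦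
    (differentiableOn_comp_extChartAt_symm_of_mdifferentiableOn (hc k l) ((hV k).inter (hV l)) x₀).mono
      fun y hy ↦ ⟨hy.1.1, hy.1.2, hy.2.2⟩
  have hcyc' : ∀ k l m, ∀ y ∈ U' k ∩ U' l ∩ U' m, c' k l y + c' l m y = c' k m y :=
    fun k l m y hy ↦ hcyc k l m (φ.symm y) ⟨⟨hy.1.1.2, hy.1.2.2⟩, hy.2.2⟩
  obtain ⟨h', hh', hhc'⟩ :=
    exists_holomorphic_cochain_of_cocycle_of_convex hCo hCc U' hU'o hU'C hcov' c' hc'd hcyc'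
  -- back to the manifold
  have hφU : ∀ k, ∀ x ∈ V k, φ x ∈ U' k := fun k x hx ↦ by
    have h1 : x ∈ chartSet 𝓘(ℝ, E) x₀ C := hVW k hx
    have hxs : x ∈ φ.source := chartSet_subset_source 𝓘(ℝ, E) x₀ C h1
    refine ⟨φ.map_source hxs, ?_⟩
    change φ.symm (φ x) ∈ V k
    rwa [φ.left_inv hxs]
  refine ⟨fun k x ↦ h' k (φ x), fun k x hx ↦ ?_, fun k l x hx ↦ ?_⟩
  · have hxs : x ∈ (chartAt E x₀).source := by
      rw [← extChartAt_source 𝓘(ℂ, E)]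
      exact chartSet_subset_source 𝓘(ℝ, E) x₀ C (hVW k hx)
    have h1 : MDifferentiableAt 𝓘(ℂ, E) 𝓘(ℂ, ℂ) (h' k) (φ x) :=
      mdifferentiableAt_iff_differentiableAt.2
        ((hh' k).differentiableAt ((hU'o k).mem_nhds (hφU k x hx)))
    have h2 : MDifferentiableAt 𝓘(ℂ, E) 𝓘(ℂ, E) φ x := mdifferentiableAt_extChartAt hxs
    exact (h1.comp x h2).mdifferentiableWithinAt
  · have hxs : x ∈ φ.source := chartSet_subset_source 𝓘(ℝ, E) x₀ C (hVW k hx.1)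
    have := hhc' k l (φ x) ⟨hφU k x hx.1, hφU l x hx.2⟩
    simp only [hc', Function.comp_apply, φ.left_inv hxs] at this
    exact this

end Manifold

end Literature.Geometry.Kaehler
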